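import Mathlib.MeasureTheory.Integral.IntervalIntegral.Basic
import Mathlib.Topology.UniformSpace.HeineCantor
import Literature.Analysis.Complex.ArgumentPrincipleRectangle

/-!
# Stability of the zero count in a rectangle under continuous deformation
(registered helper `helper_zeroCountStable` of line `cross-cap-laurent`, crux
`GromovRecognitionRelEnd`, item stmt-SmoothPoincare4-11009)

"Hurwitz's theorem with multiplicities" on a closed rectangle `K = [a,b] × [c,d]`: let `F s`
(`s` in a topological space `S`) be a family of functions analytic on a neighbourhood of every point
of `K`, jointly continuous on `S × K` together with the complex derivatives `(F s)'`, and suppose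
`F s₀` has no zero on the boundary `∂K = K ∖ K°`.  Then for all `s` near `s₀` the function `F s`
still has no zero on `∂K`, and the number of zeros of `F s` in the open rectangle `K°`, counted with
multiplicity (`meromorphicOrderAt`), equals that of `F s₀`.

Proof: (1) `∂K` is compact and `(s, z) ↦ F s z` is continuous on `S × K`, so `F s ≠ 0` on `∂K`
for `s` near `s₀` (generalised tube lemma `IsCompact.eventually_forall_of_forall_eventually`);
(2) by the argument principle on a rectangle
(`Literature.Analysis.Complex.integral_boundary_rect_logDeriv`) the zero count `N(s)` is
`(2πi)⁻¹ ∮_{∂K} (F s)'/(F s)`, and the four edge integrals depend continuously on `s` at `s₀`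
(uniform continuity of the integrand across the compact edges,
`IsCompact.mem_uniformity_of_prod`); (3) an integer-valued function `N` with `2π |N(s) - N(s₀)| < 1`
near `s₀` is constant near `s₀`.
-/

noncomputable section

open Complex Set MeasureTheory Filter Topology intervalIntegral

-- the prescribed namespace `Summit.<P>.<Sub>.…` duplicates `SmoothPoincare4` (P = Sub)
set_option linter.dupNamespace false

namespace Summit.SmoothPoincare4.SmoothPoincare4.Theorems.GromovRecognitionRelEnd.CrossCapLaurent

/-- **Continuity of a parametric interval integral at a point**, for an arbitrary topological
parameter space: if `(s, t) ↦ g s t` is continuous on `U × [α, β]` for a neighbourhood `U` of `s₀`,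
then `s ↦ ∫_α^β g s t dt` is continuous at `s₀` (the integrands converge uniformly on the compact
interval, `IsCompact.mem_uniformity_of_prod`). -/
theorem continuousAt_parametric_intervalIntegral {S E : Type*} [TopologicalSpace S]
    [NormedAddCommGroup E] [NormedSpace ℝ E] {g : S → ℝ → E} {α β : ℝ} {U : Set S} {s₀ : S}
    (hU : U ∈ 𝓝 s₀) (hαβ : α ≤ β)
    (hg : ContinuousOn (fun q : S × ℝ => g q.1 q.2) (U ×ˢ Icc α β)) :
    ContinuousAt (fun s => ∫ t in α..β, g s t) s₀ := by
  have hs₀U : s₀ ∈ U := mem_of_mem_nhds hU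
  -- the slices over points of `U` are continuous on `[α, β]`, hence interval integrable
  have hint : ∀ p ∈ U, IntervalIntegrable (g p) volume α β := by
    intro p hp
    refine ContinuousOn.intervalIntegrable ?_
    rw [uIcc_of_le hαβ]
    have h1 : Continuous fun t : ℝ => (p, t) := by fun_prop
    exact hg.comp h1.continuousOn fun t ht => ⟨hp, ht⟩
  rw [Metric.continuousAt_iff']
  intro ε hε
  obtain ⟨δ, δpos, hδ⟩ : ∃ δ : ℝ, 0 < δ ∧ (β - α) * δ < ε := exists_pos_mul_lt hε (β - α)
  obtain ⟨v, v_mem, hv⟩ := isCompact_Icc.mem_uniformity_of_prod (f := g) hg hs₀U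
    (Metric.dist_mem_uniformity δpos)
  rw [nhdsWithin_eq_nhds.2 hU] at v_mem
  filter_upwards [v_mem, hU] with s hsv hsU
  rw [dist_eq_norm, ← intervalIntegral.integral_sub (hint s hsU) (hint s₀ hs₀U)]
  calc ‖∫ t in α..β, g s t - g s₀ t‖ ≤ δ * |β - α| := by
        refine intervalIntegral.norm_integral_le_of_norm_le_const fun t ht => ?_
        rw [uIoc_of_le hαβ] at ht
        have h : dist (g s t) (g s₀ t) < δ := hv s hsv t ⟨ht.1.le, ht.2⟩
        rw [dist_eq_norm] at h
        exact h.le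
    _ = (β - α) * δ := by rw [abs_of_nonneg (sub_nonneg.2 hαβ), mul_comm]
    _ < ε := hδ

/-- The integrand `(s, t) ↦ (F s)'(γ t) / F s (γ t)` of a logarithmic-derivative edge integral is
continuous on `U × [α, β]` when `F` and the derivatives `(F s)'` are jointly continuous on `S × K`,
the continuous path `γ` maps `[α, β]` into `K`, and `F s (γ t) ≠ 0` for `s ∈ U`, `t ∈ [α, β]`. -/
theorem continuousOn_logDeriv_integrand {S : Type*} [TopologicalSpace S] {F : S → ℂ → ℂ}
    {K : Set ℂ} {U : Set S} {γ : ℝ → ℂ} {α β : ℝ}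
    (hFc : ContinuousOn (fun q : S × ℂ => F q.1 q.2) (univ ×ˢ K))
    (hFdc : ContinuousOn (fun q : S × ℂ => deriv (F q.1) q.2) (univ ×ˢ K))
    (hγ : Continuous γ) (hγK : ∀ t ∈ Icc α β, γ t ∈ K)
    (hne : ∀ s ∈ U, ∀ t ∈ Icc α β, F s (γ t) ≠ 0) :
    ContinuousOn (fun q : S × ℝ => deriv (F q.1) (γ q.2) / F q.1 (γ q.2)) (U ×ˢ Icc α β) := by
  have hmap : MapsTo (fun q : S × ℝ => (q.1, γ q.2)) (U ×ˢ Icc α β) (univ ×ˢ K) :=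
    fun q hq => ⟨mem_univ _, hγK q.2 hq.2⟩
  have hcont : Continuous (fun q : S × ℝ => (q.1, γ q.2)) := by fun_prop
  exact (hFdc.comp hcont.continuousOn hmap).div (hFc.comp hcont.continuousOn hmap)
    (fun q hq => hne q.1 hq.1 q.2 hq.2)

/-- The four edges of the closed rectangle `[a,b] × [c,d]` lie in it and miss the open rectangle:
bottom edge `x + ci`. -/
theorem bot_edge_mem {a b c d x : ℝ} (hcd : c ≤ d) (hx : x ∈ Icc a b) :
    ((x : ℂ) + c * I) ∈ Icc a b ×ℂ Icc c d ∧ ((x : ℂ) + c * I) ∉ Ioo a b ×ℂ Ioo c d := by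
  refine ⟨⟨by simpa using hx, by simpa using hcd⟩, fun h => ?_⟩
  have := h.2
  simp at this

/-- Top edge `x + di` of `[a,b] × [c,d]`: in the closed rectangle, not in the open one. -/
theorem top_edge_mem {a b c d x : ℝ} (hcd : c ≤ d) (hx : x ∈ Icc a b) :
    ((x : ℂ) + d * I) ∈ Icc a b ×ℂ Icc c d ∧ ((x : ℂ) + d * I) ∉ Ioo a b ×ℂ Ioo c d := by
  refine ⟨⟨by simpa using hx, by simpa using hcd⟩, fun h => ?_⟩
  have := h.2
  simp at this

/-- Left edge `a + yi` of `[a,b] × [c,d]`: in the closed rectangle, not in the open one. -/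
theorem left_edge_mem {a b c d y : ℝ} (hab : a ≤ b) (hy : y ∈ Icc c d) :
    ((a : ℂ) + y * I) ∈ Icc a b ×ℂ Icc c d ∧ ((a : ℂ) + y * I) ∉ Ioo a b ×ℂ Ioo c d := by
  refine ⟨⟨by simpa using hab, by simpa using hy⟩, fun h => ?_⟩
  have := h.1
  simp at this

/-- Right edge `b + yi` of `[a,b] × [c,d]`: in the closed rectangle, not in the open one. -/
theorem right_edge_mem {a b c d y : ℝ} (hab : a ≤ b) (hy : y ∈ Icc c d) :
    ((b : ℂ) + y * I) ∈ Icc a b ×ℂ Icc c d ∧ ((b : ℂ) + y * I) ∉ Ioo a b ×ℂ Ioo c d := by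
  refine ⟨⟨by simpa using hab, by simpa using hy⟩, fun h => ?_⟩
  have := h.1
  simp at this

/-- **The argument principle with an integer right-hand side.** For `f` analytic on a
neighbourhood of every point of `[a,b] × [c,d]` (`a < b`, `c < d`) and non-zero on the boundary
(stated as: non-zero at the points of the closed rectangle outside the open one),
`∮_{∂R} f'/f = 2πi · N` with `N = Σ_{ρ ∈ R°, f ρ = 0} m(ρ) ∈ ℤ`
(`Literature.Analysis.Complex.integral_boundary_rect_logDeriv`, whose right-hand side casts each
multiplicity to `ℂ` inside the finite sum). -/
theorem rect_logDeriv_eq_intCount {a b c d : ℝ} {f : ℂ → ℂ} (hab : a < b) (hcd : c < d)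
    (hf : AnalyticOnNhd ℂ f (Icc a b ×ℂ Icc c d))
    (hbd : ∀ z ∈ Icc a b ×ℂ Icc c d, z ∉ Ioo a b ×ℂ Ioo c d → f z ≠ 0) :
    (∫ x : ℝ in a..b, deriv f (x + c * I) / f (x + c * I)) -
      (∫ x : ℝ in a..b, deriv f (x + d * I) / f (x + d * I)) +
      I * (∫ y : ℝ in c..d, deriv f (b + y * I) / f (b + y * I)) -
      I * (∫ y : ℝ in c..d, deriv f (a + y * I) / f (a + y * I)) =
      2 * Real.pi * I * ((∑ᶠ ρ ∈ {ρ : ℂ | f ρ = 0 ∧ ρ ∈ Ioo a b ×ℂ Ioo c d},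
        (meromorphicOrderAt f ρ).untop₀ : ℤ) : ℂ) := by
  have h_bot : ∀ x ∈ Icc a b, f (x + c * I) ≠ 0 := fun x hx =>
    hbd _ (bot_edge_mem hcd.le hx).1 (bot_edge_mem hcd.le hx).2
  have h_top : ∀ x ∈ Icc a b, f (x + d * I) ≠ 0 := fun x hx =>
    hbd _ (top_edge_mem hcd.le hx).1 (top_edge_mem hcd.le hx).2
  have h_left : ∀ y ∈ Icc c d, f (a + y * I) ≠ 0 := fun y hy =>
    hbd _ (left_edge_mem hab.le hy).1 (left_edge_mem hab.le hy).2
  have h_right : ∀ y ∈ Icc c d, f (b + y * I) ≠ 0 := fun y hy =>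
    hbd _ (right_edge_mem hab.le hy).1 (right_edge_mem hab.le hy).2
  rw [Literature.Analysis.Complex.integral_boundary_rect_logDeriv hab hcd hf h_bot h_top h_left
    h_right]
  congr 1
  have hfin := Literature.Analysis.Complex.finite_zeros_reProdIm hab.le hcd.le hf
    (bot_edge_mem hcd.le ⟨le_rfl, hab.le⟩).1 (h_bot a ⟨le_rfl, hab.le⟩)
  rw [finsum_mem_eq_finite_toFinset_sum _ hfin, finsum_mem_eq_finite_toFinset_sum _ hfin,
    Int.cast_sum]

/-- Two integers `m`, `n` with `‖2πi (m - n)‖ < 1` are equal. -/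
theorem int_eq_of_norm_two_pi_I_mul_sub_lt_one {m n : ℤ}
    (h : ‖2 * (Real.pi : ℂ) * I * ((m : ℂ) - (n : ℂ))‖ < 1) : m = n := by
  by_contra hne
  have h1 : (1 : ℝ) ≤ |((m - n : ℤ) : ℝ)| := by
    rw [← Int.cast_abs]
    exact_mod_cast Int.one_le_abs (sub_ne_zero.2 hne)
  have h2 : ‖2 * (Real.pi : ℂ) * I * ((m : ℂ) - (n : ℂ))‖ = 2 * Real.pi * |((m - n : ℤ) : ℝ)| := by
    rw [← Int.cast_sub, norm_mul, norm_mul, norm_mul, Complex.norm_I, mul_one, Complex.norm_real,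
      Real.norm_of_nonneg Real.pi_pos.le, Complex.norm_intCast]
    norm_num
  rw [h2] at h
  nlinarith [Real.two_le_pi, h1]

/-- **Stability of the zero count (Hurwitz's theorem with multiplicities on a rectangle).**
Let `F : S → ℂ → ℂ` be a family, indexed by a topological space `S`, of functions analytic on a
neighbourhood of every point of the closed rectangle `K = [a,b] × [c,d]` (`a < b`, `c < d`), such
that `(s, z) ↦ F s z` and `(s, z) ↦ (F s)' z` are continuous on `S × K`, and suppose `F s₀` does not
vanish on `∂K` (the points of `K` outside the open rectangle `K°`).  Then for all `s` in a
neighbourhood of `s₀`, `F s` does not vanish on `∂K` and the number of zeros of `F s` in `K°`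
counted with multiplicity, `Σ_{ρ ∈ K°, F s ρ = 0} meromorphicOrderAt (F s) ρ`, equals that of
`F s₀`.  (Argument principle `Literature.Analysis.Complex.integral_boundary_rect_logDeriv` +
continuity of the boundary integral in `s` + integrality of the count.) -/
theorem helper_zeroCountStable : ∀ (S : Type) [TopologicalSpace S] (F : S → ℂ → ℂ) (a b c d : ℝ) (s₀ : S), a < b → c < d → (∀ s : S, AnalyticOnNhd ℂ (F s) (Set.Icc a b ×ℂ Set.Icc c d)) → ContinuousOn (fun q : S × ℂ => F q.1 q.2) (Set.univ ×ˢ (Set.Icc a b ×ℂ Set.Icc c d)) → ContinuousOn (fun q : S × ℂ => deriv (F q.1) q.2) (Set.univ ×ˢ (Set.Icc a b ×ℂ Set.Icc c d)) → (∀ z ∈ Set.Icc a b ×ℂ Set.Icc c d, z ∉ Set.Ioo a b ×ℂ Set.Ioo c d → F s₀ z ≠ 0) → ∀ᶠ s in nhds s₀, (∀ z ∈ Set.Icc a b ×ℂ Set.Icc c d, z ∉ Set.Ioo a b ×ℂ Set.Ioo c d → F s z ≠ 0) ∧ ∑ᶠ ρ ∈ {ρ : ℂ | F s ρ = 0 ∧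 ρ ∈ Set.Ioo a b ×ℂ Set.Ioo c d}, (meromorphicOrderAt (F s) ρ).untop₀ = ∑ᶠ ρ ∈ {ρ : ℂ | F s₀ ρ = 0 ∧ ρ ∈ Set.Ioo a b ×ℂ Set.Ioo c d}, (meromorphicOrderAt (F s₀) ρ).untop₀ := by
  intro S _ F a b c d s₀ hab hcd hF hFc hFdc hs₀
  -- Step 1: persistence of non-vanishing on the (compact) boundary `K \ K°`.
  have h1 : ∀ᶠ s in 𝓝 s₀, ∀ z ∈ Icc a b ×ℂ Icc c d, z ∉ Ioo a b ×ℂ Ioo c d → F s z ≠ 0 := by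
    have hK : IsCompact ((Icc a b ×ℂ Icc c d) \ (Ioo a b ×ℂ Ioo c d)) :=
      (isCompact_Icc.reProdIm isCompact_Icc).diff (isOpen_Ioo.reProdIm isOpen_Ioo)
    have h := hK.eventually_forall_of_forall_eventually (x₀ := s₀)
      (P := fun s z => z ∈ Icc a b ×ℂ Icc c d → F s z ≠ 0) ?_
    · filter_upwards [h] with s hs z hz hz'
      exact hs z ⟨hz, hz'⟩ hz
    · intro z hz
      have hcont : ContinuousWithinAt (fun q : S × ℂ => F q.1 q.2)
          (univ ×ˢ (Icc a b ×ℂ Icc c d)) (s₀, z) := hFc (s₀, z) ⟨mem_univ _, hz.1⟩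
      have hne : ∀ᶠ q in 𝓝[univ ×ˢ (Icc a b ×ℂ Icc c d)] (s₀, z), F q.1 q.2 ≠ 0 :=
        hcont.tendsto.eventually_ne (hs₀ z hz.1 hz.2)
      rw [eventually_nhdsWithin_iff] at hne
      filter_upwards [hne] with q hq hqK
      exact hq ⟨mem_univ _, hqK⟩
  -- the neighbourhood `U` of `s₀` on which `F s` has no zero on the boundary
  set U : Set S := {s | ∀ z ∈ Icc a b ×ℂ Icc c d, z ∉ Ioo a b ×ℂ Ioo c d → F s z ≠ 0} with hU_def
  have hU : U ∈ 𝓝 s₀ := h1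
  -- Step 2: the four edge integrals of `(F s)'/(F s)` are continuous in `s` at `s₀`.
  have cB : ContinuousAt (fun s => ∫ x in a..b, deriv (F s) (x + c * I) / F s (x + c * I)) s₀ :=
    continuousAt_parametric_intervalIntegral
      (g := fun s (x : ℝ) => deriv (F s) (x + c * I) / F s (x + c * I)) hU hab.le
      (continuousOn_logDeriv_integrand (γ := fun x : ℝ => (x : ℂ) + c * I) hFc hFdc
        (by fun_prop) (fun x hx => (bot_edge_mem hcd.le hx).1)
        (fun s hs x hx => hs _ (bot_edge_mem hcd.le hx).1 (bot_edge_mem hcd.le hx).2))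
  have cT : ContinuousAt (fun s => ∫ x in a..b, deriv (F s) (x + d * I) / F s (x + d * I)) s₀ :=
    continuousAt_parametric_intervalIntegral
      (g := fun s (x : ℝ) => deriv (F s) (x + d * I) / F s (x + d * I)) hU hab.le
      (continuousOn_logDeriv_integrand (γ := fun x : ℝ => (x : ℂ) + d * I) hFc hFdc
        (by fun_prop) (fun x hx => (top_edge_mem hcd.le hx).1)
        (fun s hs x hx => hs _ (top_edge_mem hcd.le hx).1 (top_edge_mem hcd.le hx).2))
  have cR : ContinuousAt (fun s => ∫ y in c..d, deriv (F s) (b + y * I) / F s (b + y * I)) s₀ :=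
    continuousAt_parametric_intervalIntegral
      (g := fun s (y : ℝ) => deriv (F s) (b + y * I) / F s (b + y * I)) hU hcd.le
      (continuousOn_logDeriv_integrand (γ := fun y : ℝ => (b : ℂ) + y * I) hFc hFdc
        (by fun_prop) (fun y hy => (right_edge_mem hab.le hy).1)
        (fun s hs y hy => hs _ (right_edge_mem hab.le hy).1 (right_edge_mem hab.le hy).2))
  have cL : ContinuousAt (fun s => ∫ y in c..d, deriv (F s) (a + y * I) / F s (a + y * I)) s₀ :=
    continuousAt_parametric_intervalIntegral
      (g := fun s (y : ℝ) => deriv (F s) (a + y * I) / F s (a + y * I)) hU hcd.le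
      (continuousOn_logDeriv_integrand (γ := fun y : ℝ => (a : ℂ) + y * I) hFc hFdc
        (by fun_prop) (fun y hy => (left_edge_mem hab.le hy).1)
        (fun s hs y hy => hs _ (left_edge_mem hab.le hy).1 (left_edge_mem hab.le hy).2))
  have cΦ : ContinuousAt (fun s =>
      (∫ x in a..b, deriv (F s) (x + c * I) / F s (x + c * I)) -
      (∫ x in a..b, deriv (F s) (x + d * I) / F s (x + d * I)) +
      I * (∫ y in c..d, deriv (F s) (b + y * I) / F s (b + y * I)) -
      I * (∫ y in c..d, deriv (F s) (a + y * I) / F s (a + y * I))) s₀ :=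
    ((cB.sub cT).add (continuousAt_const.mul cR)).sub (continuousAt_const.mul cL)
  have hev := (Metric.continuousAt_iff'.1 cΦ) 1 one_pos
  -- Step 3: combine with the argument principle and integrality of the zero count.
  filter_upwards [h1, hev] with s hs hds
  refine ⟨hs, ?_⟩
  rw [rect_logDeriv_eq_intCount hab hcd (hF s) hs, rect_logDeriv_eq_intCount hab hcd (hF s₀) hs₀,
    dist_eq_norm, ← mul_sub] at hds
  exact int_eq_of_norm_two_pi_I_mul_sub_lt_one hds

end Summit.SmoothPoincare4.SmoothPoincare4.Theorems.GromovRecognitionRelEnd.CrossCapLaurent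

end
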